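import Summits.ResolutionOfSingularities.ResolutionOfSingularities.Theorems.HomologicalConductorNoZenoExitDivisor
import Literature.AlgebraicGeometry.Resolution.LipmanValuativeQuadraticSequenceDivisorial
import HarnessLib

/-!
# Crux `NoZeno` / `NoZenoR` (stmt-ResolutionOfSingularities-16483 / -19943), line `sandwich-cluster`:
# the exit divisor is a DISCRETE valuation ring essentially of finite type over the base

Route `ResolutionOfSingularities/HomologicalConductor`.  OURS (cell res-hironaka); nothing here is a
statement of the manuscript under review.  Two finiteness properties of the exit divisor `W` of a
singular step of the canonical `ca`-tower (`exists_exitDivisor`, `…ExitDivisor.lean`), in the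
hypothesis shape of the tree's «DVR reach» (`RuledResidues.RegularModelRuled.dvrReach`: the
quadratic sequence of a local ring of `K` along a discrete valuation ring `W` essentially of finite
type over it reaches `W`), so that Zariski's theorem «a prime divisor of a two-dimensional regular
local ring is the order valuation of an infinitely near point» applies to `W` over the sandwich base
`R`:

* `isDiscreteValuationRing_of_residuallyTranscendental` — a residually transcendental valuation ring
  `W ≠ K` of the function field `K/k` of transcendence degree `2` (`K = Frac A`, `A` finitely
  generated) is a discrete valuation ring (prime divisors are discrete of rank one, Zariski–Samuel
  VI §14 Thm 31; tree `Lipman1978ValuativeQuadraticSequence.isDiscreteValuationRing_of_residuallyTranscendental`).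
* `exists_finset_le_locAtCentre` — if `W ⊇ T'` is essentially generated by a `k`-subalgebra `T'`
  essentially of finite type over `k` (`w = a * s⁻¹`, `a, s ∈ T'`, `s⁻¹ ∈ W`) then for every
  `R ≤ T'` there is a finite `S ⊆ W` with `W ⊆ (R[S])_{𝔪_W ∩ R[S]}`, i.e.
  `W.toSubring ≤ locAtCentre (Subring.closure (R ∪ S)) W`.

References: O. Zariski, P. Samuel, Commutative Algebra II (1960), Ch. VI §14, Thm 31
[`ZariskiSamuel1960`]; S. Abhyankar, Amer. J. Math. 78 (1956), Prop. 3 [`Abhyankar1956Valuations`].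
-/

noncomputable section

-- single-problem summit: the doubled namespace component `ResolutionOfSingularities` is forced
set_option linter.dupNamespace false

namespace Summit.ResolutionOfSingularities.ResolutionOfSingularities.Theorems.NoZeno.SandwichCluster

open Summit.ResolutionOfSingularities.ResolutionOfSingularities.Theses.HomologicalConductor
open Summit.ResolutionOfSingularities.ResolutionOfSingularities.Theorems.NoZeno.Birth
open Literature.AlgebraicGeometry.Resolution IsLocalRing Polynomial

variable {k K : Type} [Field k] [Field K] [Algebra k K]

/-- **A residually transcendental valuation ring of `K/k` is a discrete valuation ring** when `K`
is the fraction field of a finitely generated `k`-algebra `A` of transcendence degree `2` and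
`W ≠ K`. [cite: ZariskiSamuel1960, Ch. VI §14, Thm. 31] -/
theorem isDiscreteValuationRing_of_residuallyTranscendental (A : Subalgebra k K) (hA : A.FG)
    (hfr : IsFractionRing ↥A K) (htr : Algebra.trdeg k K = 2) (W : ValuationSubring K)
    (hW : W ≠ ⊤) (hkW : ∀ c : k, algebraMap k K c ∈ W)
    (htt : ∃ t ∈ W, ∀ p : k[X], p ≠ 0 → W.valuation (aeval t p) = 1) :
    IsDiscreteValuationRing ↥W := by
  haveI : Algebra.FiniteType k ↥A := (Subalgebra.fg_iff_finiteType A).mp hA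
  have hE : Algebra.EssFiniteType k ↥A := inferInstance
  have hfg : (⊤ : IntermediateField k K).FG :=
    Lipman1978ValuativeQuadraticSequence.intermediateField_fg_top_of_essFiniteType A hE hfr
  obtain ⟨t, -, htt⟩ := htt
  exact Lipman1978ValuativeQuadraticSequence.isDiscreteValuationRing_of_residuallyTranscendental
    W hkW htr hfg hW htt

/-- Elements of `k[σ] ⊆ T'` lie, as elements of `K`, in any subring containing `R ⊇ k` and the
images of `σ`. [folklore] -/
theorem coe_mem_closure_of_mem_adjoin {T' R : Subalgebra k K} (σ : Finset ↥T')
    {N : Subring K} (hRN : R.toSubring ≤ N) (hσN : ∀ x ∈ σ, (x : K) ∈ N) {b : ↥T'}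
    (hb : b ∈ Algebra.adjoin k (σ : Set ↥T')) : (b : K) ∈ N := by
  induction hb using Algebra.adjoin_induction with
  | mem x hx => exact hσN x hx
  | algebraMap c =>
    have : ((algebraMap k ↥T' c : ↥T') : K) = algebraMap k K c := rfl
    rw [this]
    exact hRN (R.algebraMap_mem c)
  | add x y _ _ hx hy => rw [Subalgebra.coe_add]; exact N.add_mem hx hy
  | mul x y _ _ hx hy => rw [Subalgebra.coe_mul]; exact N.mul_mem hx hy

/-- A unit of a `k`-subalgebra `T' ⊆ W` is a `W`-unit: valuation `1`. [folklore] -/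
theorem valuation_coe_eq_one_of_isUnit (W : ValuationSubring K) {T' : Subalgebra k K}
    (hT'W : T'.toSubring ≤ W.toSubring) {t : ↥T'} (ht : IsUnit t) : W.valuation (t : K) = 1 := by
  have ht0 : (t : K) ≠ 0 := fun h => ht.ne_zero (Subtype.ext h)
  exact SyzygyFlattening.valuation_eq_one_of_inv_mem W (hT'W t.2) (hT'W (inv_mem_of_isUnit ht)) ht0

/-- **The exit divisor is essentially of finite type over the base.**  Let `T'` be a
`k`-subalgebra of `K` essentially of finite type over `k`, `W ⊇ T'` a valuation ring of `K`
essentially generated by `T'` (`w = a * s⁻¹`, `a, s ∈ T'`, `s⁻¹ ∈ W`) and `R` any `k`-subalgebra.  Then for some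
finite `S ⊆ W`, every element of `W` is `y / z` with `y, z ∈ R[S]` (the subring generated by `R`
and `S`) and `z` a unit of `W`: `W ⊆ locAtCentre R[S] W` — the hypothesis of the tree's `dvrReach`.
[cite: Abhyankar1956Valuations, Prop. 3] -/
theorem exists_finset_le_locAtCentre (W : ValuationSubring K) (T' R : Subalgebra k K)
    [Algebra.EssFiniteType k ↥T'] (hT'W : T'.toSubring ≤ W.toSubring)
    (hgen : ∀ w ∈ W, ∃ a ∈ T', ∃ s ∈ T', s⁻¹ ∈ W ∧ w = a * s⁻¹) :
    ∃ S : Finset K, (↑S : Set K) ⊆ W ∧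
      W.toSubring ≤ locAtCentre (Subring.closure ((R : Set K) ∪ ↑S)) W := by
  classical
  -- the finitely generated model `k[σ] ⊆ T'` of which `T'` is a localisation
  set σ : Finset ↥T' := Algebra.EssFiniteType.finset k ↥T' with hσ
  have hcond : ∀ s : ↥T', ∃ t ∈ Algebra.adjoin k (σ : Set ↥T'),
      IsUnit t ∧ s * t ∈ Algebra.adjoin k (σ : Set ↥T') :=
    (Algebra.essFiniteType_cond_iff k ↥T' σ).mp
      (Algebra.EssFiniteType.isLocalization (R := k) (S := ↥T'))
  refine ⟨σ.image (fun x : ↥T' => (x : K)), ?_, ?_⟩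
  · intro x hx
    obtain ⟨y, -, rfl⟩ := Finset.mem_image.mp (Finset.mem_coe.mp hx)
    exact hT'W y.2
  set N : Subring K := Subring.closure ((R : Set K) ∪ ↑(σ.image (fun x : ↥T' => (x : K))))
    with hN
  have hRN : R.toSubring ≤ N := fun x hx => Subring.subset_closure (Or.inl hx)
  have hσN : ∀ x ∈ σ, (x : K) ∈ N := fun x hx =>
    Subring.subset_closure (Or.inr (Finset.mem_coe.mpr (Finset.mem_image_of_mem _ hx)))
  have hBN : ∀ {b : ↥T'}, b ∈ Algebra.adjoin k (σ : Set ↥T') → (b : K) ∈ N :=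
    fun hb => coe_mem_closure_of_mem_adjoin σ hRN hσN hb
  intro w hw
  obtain ⟨a, ha, s, hs, hsW, rfl⟩ := hgen w hw
  by_cases hs0 : s = 0
  · rw [hs0, inv_zero, mul_zero]; exact Subring.zero_mem _
  obtain ⟨ta, hta, htau, hata⟩ := hcond ⟨a, ha⟩
  obtain ⟨ts, hts, htsu, hsts⟩ := hcond ⟨s, hs⟩
  have hta0 : (ta : K) ≠ 0 := fun h => htau.ne_zero (Subtype.ext h)
  have hts0 : (ts : K) ≠ 0 := fun h => htsu.ne_zero (Subtype.ext h)
  rw [mem_locAtCentre_iff]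
  refine ⟨a * (ta : K) * (ts : K), ?_, s * (ts : K) * (ta : K), ?_, ?_, ?_⟩
  · -- numerator `(a tₐ) tₛ ∈ k[σ] ⊆ N`
    have h1 : ((⟨a, ha⟩ * ta : ↥T') : K) ∈ N := hBN hata
    rw [Subalgebra.coe_mul] at h1
    exact N.mul_mem h1 (hBN hts)
  · -- denominator `(s tₛ) tₐ ∈ k[σ] ⊆ N`
    have h1 : ((⟨s, hs⟩ * ts : ↥T') : K) ∈ N := hBN hsts
    rw [Subalgebra.coe_mul] at h1
    exact N.mul_mem h1 (hBN hta)
  · -- the denominator is a `W`-unit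
    have hsv : W.valuation s = 1 :=
      SyzygyFlattening.valuation_eq_one_of_inv_mem W (hT'W hs) hsW hs0
    rw [map_mul, map_mul, hsv, valuation_coe_eq_one_of_isUnit W hT'W htsu,
      valuation_coe_eq_one_of_isUnit W hT'W htau, one_mul, one_mul]
  · field_simp

end Summit.ResolutionOfSingularities.ResolutionOfSingularities.Theorems.NoZeno.SandwichCluster

end
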